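import Summits.HodgeConjecture.HodgeConjecture.Theorems.Ring2WeilCoverageWeilGramLevel15SqrtNegFifteenTypeFive
import HarnessLib

/-!
# Weil-type family coverage — THE COMPONENTS OF THE WEIL-TYPE `ℤ[ζ₁₅]`-FOURFOLDS, V: `K_d = ℚ(√−15)`, type `𝔮₃`
# (`π₃ = ζ¹²(1 − ζ⁵)(1 − ζ)`, `(𝔬𝔣₀)² = (3)`, degree `9`): `det a = 32400 = 180²` — the SPLIT class: row W4.15.1

research route conditional on HC_CM; not a corollary; Q11.4-sentence-2 already refuted in dim ≥ 3.

Ring 2, WEIL-TYPE FAMILY-COVERAGE CENSUS (`HOME/WEIL-FAMILY-COVERAGE.md` `## b01`, block b01.47 (C2)/(E): «type `𝔮₃`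
(degree `9`): `1296 = 36²` — SPLIT row W4.3.1 (kernel; the `√−15` analogue `32400 = 180²` computed, not filed)» —
S-pencil there), part 118 of the `Ring2WeilCoverage*` series; the last of gen 67's `g = 4` numbers, filed by gen 68;
continues parts 83–86 (frame `θ^i`, `θ = ζ + ζ⁻¹`; `s₁₅ = (1 + 2ζ⁵)(1 + 2(ζ³ + ζ¹²))`, `ξ = ζ³/Φ₁₅′(ζ)`).  Part 80
(`Ring2WeilCoverageRamifiedTypesLevel15`) proved that every `ℚ(√−15)`-balanced CM type `Φ` of `ℚ(ζ₁₅)` carries a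
`Φ`-positive divisor of type `𝔣₀`, `𝔬𝔣₀ = (π₃)`, `(𝔬𝔣₀)² = (3)`.

* §1 the seven traces `Tr(π₃ξ s₁₅ θ^m)` and the Gram datum: **`det a(π₃ξ, s₁₅) = 32400 = 180²`**
  (`= N_{K⁺/ℚ}(π₃)·det a(ξ, s₁₅) = (−9)·(−3600)`, part 82's component rule in numbers).
* §2 **EVERY skew `ζ′` of type `𝔮₃` on `ℤ[ζ₁₅]` gives `32400`** against `s₁₅` (part 82 + THEOREM L (i) at `15`);
  CENSUS FORM `exists_typeThree_sqrtNegFifteen_det` (part 80's existence + the determinant).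
* §3 class **`[32400] = [1]` = SPLIT** in `ℚˣ/Nm(ℚ(√−15)ˣ)`, right sign `(−1)² det a > 0`: the type-`𝔮₃` (degree `9`)
  polarised Weil-type `ℤ[ζ₁₅]`-fourfolds for `ℚ(√−15)` lie on the SPLIT row W4.15.1 — so at level `15` BOTH fields see
  the same picture: `𝔮₅` ↦ NON-split (`[5]`, parts 84/86), `𝔮₃` ↦ SPLIT (part 84 and this file).

HONEST FRAMING as parts 82–86; `HC_CM` is used nowhere.  No `def`, no named fact, no `sorry`.  Certificates from gen 67's
`work/py/gen15.py` (exact arithmetic in `ℚ[x]/Φ₁₅`), re-verified by `linear_combination`.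

References: [cite: vanGeemen1994HodgeAV, Lemma 5.2 (2)–(4), 5.4 and (5.4.1)]; [cite: Shimura1998, §14.3 Prop. 4–5,
pp. 103–104]; census b01.46 (C2), b01.47 (C2)/(E) (seat-derived).
-/

noncomputable section

open Polynomial NumberField Module
open scoped nonZeroDivisors

namespace Summit.HodgeConjecture.Ring2WeilCoverage.WeilGramLevel15SqrtNegFifteenTypeThree

open Literature.AlgebraicGeometry.VanGeemen1994 (weilField weilNormResidueGroup)
open Literature.AlgebraicGeometry.Motives (CMType normUnitsSubgroup)
open Literature.NumberTheory.ComplexMultiplication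
open Summit.HodgeConjecture.Ring2WeilCoverage.WeilGramCMPoint
open Summit.HodgeConjecture.Ring2WeilCoverage.WeilGramLevel15
open Summit.HodgeConjecture.Ring2WeilCoverage.WeilGramLevel15SqrtNegFifteen
open Summit.HodgeConjecture.Ring2WeilCoverage.RealUnitNormHalfSystems (complexConj_eq_inv)
open Summit.HodgeConjecture.Ring2WeilCoverage.CyclotomicDifferent (isOfType_one_xi_top xi_ne_zero)
open Summit.HodgeConjecture.Ring2WeilCoverage.RamifiedTypes (isOfType_one_gen_mul_xi complexConj_gen_mul_xi gen_ne_zero)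
open Summit.HodgeConjecture.Ring2WeilCoverage.RamifiedTypesLevel15
open Summit.HodgeConjecture.Ring2WeilCoverage.RealUnitNormAllLevels (norm_realUnits_pos_fifteen)
open Summit.HodgeConjecture.HodgeConjecture.Ring2.WeilCoverage (mk_ne_split_of_even mk_eq_split_of_even
  natCast_not_mem_normUnitsSubgroup_of_inert natCast_not_mem_normUnitsSubgroup_of_ramified
  not_mem_normUnitsSubgroup_of_not_exists mem_normUnitsSubgroup_of_sq_add_mul_sq)
open Summit.HodgeConjecture.HodgeConjecture.Ring2.Hypotheses (splitDiscriminantClass)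

variable {K : Type} [Field K] [NumberField K] {ζ : K}

/-- `𝐞(t) = exp(2πi t/n) ∈ ℂ` (`ZMod.toCircle`). -/
local notation3 (prettyPrint := false) "𝐞 " t:max => ((ZMod.toCircle t : Circle) : ℂ)

/-- the residue set `S_Φ` read at level `15`. -/
local notation3 (prettyPrint := false) "SΦ[" Φ "," z "]" =>
  (Finset.univ.filter fun t : ZMod 15 => ∃ σ ∈ (Φ : CMType K).1, σ (z : K) = 𝐞 t)

/-! ### §1 Type `𝔮₃` for `K_d = ℚ(√−15)`: `det a = 32400` -/

/-- `Tr(ζ′sθ^0) = 0` for `ζ′ = π₃ξ, π₃ = ζ¹²(1 − ζ⁵)(1 − ζ)`, `s = √−15 = (1 + 2ζ⁵)(1 + 2(ζ³ + ζ¹²))`, `θ = ζ + ζ⁻¹` (Euler evaluation). research route conditional on HC_CM; not a corollary; Q11.4-sentence-2 already refuted in dim ≥ 3. [folklore] -/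
theorem trace_piThree_sqrtNegFifteen_zero [IsCyclotomicExtension {15} ℚ K] (hζ : IsPrimitiveRoot ζ 15) :
    Algebra.trace ℚ K ((ζ ^ 12 * (1 - ζ ^ 5) * (1 - ζ) * (ζ ^ 3 * (aeval ζ (derivative (cyclotomic 15 ℚ)))⁻¹)) * ((1 + 2 * ζ ^ 5) * (1 + 2 * (ζ ^ 3 + ζ ^ 12)))) = 0 := by
  have h15 : ζ ^ 15 = 1 := hζ.pow_eq_one
  have hΦ := cyc_fifteen hζ
  rw [trace_of_key₀ hζ (C (-3 : ℚ) + C (9 : ℚ) * X + C (-6 : ℚ) * X ^ 2 + C (6 : ℚ) * X ^ 4 + C (-9 : ℚ) * X ^ 5 +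
      C (3 : ℚ) * X ^ 6 + C (0 : ℚ) * X ^ 7) (by compute_degree) (by
    simp only [map_add, map_mul, map_pow, aeval_C, aeval_X, map_neg, eq_ratCast, Rat.cast_ofNat]
    linear_combination ((aeval ζ (derivative (cyclotomic 15 ℚ)))⁻¹ * (4 - 6 * ζ + 2 * ζ^2 - 2 * ζ^3 - 2 * ζ^5 + 4 * ζ^6)) * hΦ +
      ((aeval ζ (derivative (cyclotomic 15 ℚ)))⁻¹ * (1 - ζ + 2 * ζ^2 - 2 * ζ^4 + ζ^5 - ζ^6 - 4 * ζ^7 +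
        6 * ζ^8 - 2 * ζ^9 - 2 * ζ^10 + 2 * ζ^11 + 2 * ζ^12 - 6 * ζ^13 + 4 * ζ^14 +
        2 * ζ^17 - 2 * ζ^18 - 4 * ζ^22 + 4 * ζ^23)) * h15)]
  norm_num [coeff_X_pow, coeff_X, coeff_C]

/-- `Tr(ζ′sθ^1) = 6` for `ζ′ = π₃ξ, π₃ = ζ¹²(1 − ζ⁵)(1 − ζ)`, `s = √−15 = (1 + 2ζ⁵)(1 + 2(ζ³ + ζ¹²))`, `θ = ζ + ζ⁻¹` (Euler evaluation). research route conditional on HC_CM; not a corollary; Q11.4-sentence-2 already refuted in dim ≥ 3. [folklore] -/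
theorem trace_piThree_sqrtNegFifteen_one [IsCyclotomicExtension {15} ℚ K] (hζ : IsPrimitiveRoot ζ 15) :
    Algebra.trace ℚ K ((ζ ^ 12 * (1 - ζ ^ 5) * (1 - ζ) * (ζ ^ 3 * (aeval ζ (derivative (cyclotomic 15 ℚ)))⁻¹)) * ((1 + 2 * ζ ^ 5) * (1 + 2 * (ζ ^ 3 + ζ ^ 12))) * (ζ + ζ⁻¹)) = 6 := by
  have h15 : ζ ^ 15 = 1 := hζ.pow_eq_one
  have hΦ := cyc_fifteen hζ
  rw [trace_of_key₁ hζ (C (6 : ℚ) + C (-9 : ℚ) * X + C (12 : ℚ) * X ^ 2 + C (-3 : ℚ) * X ^ 3 + C (-6 : ℚ) * X ^ 4 +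
      C (9 : ℚ) * X ^ 5 + C (-12 : ℚ) * X ^ 6 + C (6 : ℚ) * X ^ 7) (by compute_degree) (by
    simp only [map_add, map_mul, map_pow, aeval_C, aeval_X, map_neg, eq_ratCast, Rat.cast_ofNat]
    linear_combination ((aeval ζ (derivative (cyclotomic 15 ℚ)))⁻¹ * (-5 - 8 * ζ + 4 * ζ^2 - 4 * ζ^3 + 2 * ζ^4 + 2 * ζ^5 +
        6 * ζ^6)) * hΦ +
      ((aeval ζ (derivative (cyclotomic 15 ℚ)))⁻¹ * (-5 + 3 * ζ + 3 * ζ^2 - ζ^3 + ζ^5 - 3 * ζ^6 - 3 * ζ^7 +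
        5 * ζ^8 - 6 * ζ^9 + 4 * ζ^10 - 4 * ζ^13 + 6 * ζ^14 - 6 * ζ^15 + 4 * ζ^16 + 2 * ζ^17 - 2 * ζ^18 +
        2 * ζ^19 - 2 * ζ^20 - 4 * ζ^22 + 4 * ζ^23 - 4 * ζ^24 + 4 * ζ^25)) * h15)]
  norm_num [coeff_X_pow, coeff_X, coeff_C]

/-- `Tr(ζ′sθ^2) = -12` for `ζ′ = π₃ξ, π₃ = ζ¹²(1 − ζ⁵)(1 − ζ)`, `s = √−15 = (1 + 2ζ⁵)(1 + 2(ζ³ + ζ¹²))`, `θ = ζ + ζ⁻¹` (Euler evaluation). research route conditional on HC_CM; not a corollary; Q11.4-sentence-2 already refuted in dim ≥ 3. [folklore] -/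
theorem trace_piThree_sqrtNegFifteen_two [IsCyclotomicExtension {15} ℚ K] (hζ : IsPrimitiveRoot ζ 15) :
    Algebra.trace ℚ K ((ζ ^ 12 * (1 - ζ ^ 5) * (1 - ζ) * (ζ ^ 3 * (aeval ζ (derivative (cyclotomic 15 ℚ)))⁻¹)) * ((1 + 2 * ζ ^ 5) * (1 + 2 * (ζ ^ 3 + ζ ^ 12))) * (ζ + ζ⁻¹) ^ 2) = -12 := by
  have h15 : ζ ^ 15 = 1 := hζ.pow_eq_one
  have hΦ := cyc_fifteen hζ
  rw [trace_of_key hζ (C (-9 : ℚ) + C (24 : ℚ) * X + C (-18 : ℚ) * X ^ 2 + C (6 : ℚ) * X ^ 3 + C (6 : ℚ) * X ^ 4 +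
      C (-24 : ℚ) * X ^ 5 + C (21 : ℚ) * X ^ 6 + C (-12 : ℚ) * X ^ 7) (by compute_degree) (by
    simp only [map_add, map_mul, map_pow, aeval_C, aeval_X, map_neg, eq_ratCast, Rat.cast_ofNat]
    linear_combination ((aeval ζ (derivative (cyclotomic 15 ℚ)))⁻¹ * (-9 + 7 * ζ^2 - 6 * ζ^3 + 6 * ζ^4 + 2 * ζ^5 +
        6 * ζ^6)) * hΦ +
      ((aeval ζ (derivative (cyclotomic 15 ℚ)))⁻¹ * (-9 + 9 * ζ - 2 * ζ^2 + 2 * ζ^3 +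
        3 * ζ^4 - 3 * ζ^6 - 2 * ζ^7 + 2 * ζ^8 - 9 * ζ^9 + 9 * ζ^10 - 6 * ζ^11 + 4 * ζ^12 - 4 * ζ^13 +
        6 * ζ^14 - 10 * ζ^15 + 10 * ζ^16 - 4 * ζ^17 + 2 * ζ^18 + 4 * ζ^19 - 4 * ζ^20 + 2 * ζ^21 - 6 * ζ^22 +
        4 * ζ^23 - 8 * ζ^24 + 8 * ζ^25 - 4 * ζ^26 + 4 * ζ^27)) * h15)]
  norm_num [coeff_X_pow, coeff_X, coeff_C]

/-- `Tr(ζ′sθ^3) = 18` for `ζ′ = π₃ξ, π₃ = ζ¹²(1 − ζ⁵)(1 − ζ)`, `s = √−15 = (1 + 2ζ⁵)(1 + 2(ζ³ + ζ¹²))`, `θ = ζ + ζ⁻¹` (Euler evaluation). research route conditional on HC_CM; not a corollary; Q11.4-sentence-2 already refuted in dim ≥ 3. [folklore] -/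
theorem trace_piThree_sqrtNegFifteen_three [IsCyclotomicExtension {15} ℚ K] (hζ : IsPrimitiveRoot ζ 15) :
    Algebra.trace ℚ K ((ζ ^ 12 * (1 - ζ ^ 5) * (1 - ζ) * (ζ ^ 3 * (aeval ζ (derivative (cyclotomic 15 ℚ)))⁻¹)) * ((1 + 2 * ζ ^ 5) * (1 + 2 * (ζ ^ 3 + ζ ^ 12))) * (ζ + ζ⁻¹) ^ 3) = 18 := by
  have h15 : ζ ^ 15 = 1 := hζ.pow_eq_one
  have hΦ := cyc_fifteen hζ
  rw [trace_of_key hζ (C (27 : ℚ) + C (-39 : ℚ) * X + C (39 : ℚ) * X ^ 2 + C (-9 : ℚ) * X ^ 3 + C (-21 : ℚ) * X ^ 4 +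
      C (39 : ℚ) * X ^ 5 + C (-45 : ℚ) * X ^ 6 + C (18 : ℚ) * X ^ 7) (by compute_degree) (by
    simp only [map_add, map_mul, map_pow, aeval_C, aeval_X, map_neg, eq_ratCast, Rat.cast_ofNat]
    linear_combination ((aeval ζ (derivative (cyclotomic 15 ℚ)))⁻¹ * (-13 + 2 * ζ - 9 * ζ^2 - 12 * ζ^3 + 13 * ζ^4 +
        10 * ζ^6)) * hΦ +
      ((aeval ζ (derivative (cyclotomic 15 ℚ)))⁻¹ * (-13 + 15 * ζ - 11 * ζ^2 + 11 * ζ^3 + ζ^4 +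
        2 * ζ^5 - 2 * ζ^7 - ζ^8 - 11 * ζ^9 + 11 * ζ^10 - 15 * ζ^11 + 13 * ζ^12 - 10 * ζ^13 +
        10 * ζ^14 - 14 * ζ^15 + 16 * ζ^16 - 14 * ζ^17 + 12 * ζ^18 - 2 * ζ^20 + 6 * ζ^21 - 10 * ζ^22 +
        6 * ζ^23 - 14 * ζ^24 + 12 * ζ^25 - 12 * ζ^26 + 12 * ζ^27 - 4 * ζ^28 + 4 * ζ^29)) * h15)]
  norm_num [coeff_X_pow, coeff_X, coeff_C]

/-- `Tr(ζ′sθ^4) = -54` for `ζ′ = π₃ξ, π₃ = ζ¹²(1 − ζ⁵)(1 − ζ)`, `s = √−15 = (1 + 2ζ⁵)(1 + 2(ζ³ + ζ¹²))`, `θ = ζ + ζ⁻¹` (Euler evaluation). research route conditional on HC_CM; not a corollary; Q11.4-sentence-2 already refuted in dim ≥ 3. [folklore] -/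
theorem trace_piThree_sqrtNegFifteen_four [IsCyclotomicExtension {15} ℚ K] (hζ : IsPrimitiveRoot ζ 15) :
    Algebra.trace ℚ K ((ζ ^ 12 * (1 - ζ ^ 5) * (1 - ζ) * (ζ ^ 3 * (aeval ζ (derivative (cyclotomic 15 ℚ)))⁻¹)) * ((1 + 2 * ζ ^ 5) * (1 + 2 * (ζ ^ 3 + ζ ^ 12))) * (ζ + ζ⁻¹) ^ 4) = -54 := by
  have h15 : ζ ^ 15 = 1 := hζ.pow_eq_one
  have hΦ := cyc_fifteen hζ
  rw [trace_of_key hζ (C (-30 : ℚ) + C (84 : ℚ) * X + C (-75 : ℚ) * X ^ 2 + C (27 : ℚ) * X ^ 3 + C (21 : ℚ) * X ^ 4 +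
      C (-84 : ℚ) * X ^ 5 + C (84 : ℚ) * X ^ 6 + C (-54 : ℚ) * X ^ 7) (by compute_degree) (by
    simp only [map_add, map_mul, map_pow, aeval_C, aeval_X, map_neg, eq_ratCast, Rat.cast_ofNat]
    linear_combination ((aeval ζ (derivative (cyclotomic 15 ℚ)))⁻¹ * (-23 + 2 * ζ - 22 * ζ^2 + 27 * ζ^3 + 22 * ζ^4 - 2 * ζ^5 +
        23 * ζ^6)) * hΦ +
      ((aeval ζ (derivative (cyclotomic 15 ℚ)))⁻¹ * (-23 + 25 * ζ - 24 * ζ^2 + 26 * ζ^3 - 10 * ζ^4 + 13 * ζ^5 +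
        ζ^6 - ζ^8 - 13 * ζ^9 + 10 * ζ^10 - 26 * ζ^11 + 24 * ζ^12 - 25 * ζ^13 + 23 * ζ^14 - 24 * ζ^15 +
        26 * ζ^16 - 28 * ζ^17 + 28 * ζ^18 - 14 * ζ^19 + 10 * ζ^20 + 6 * ζ^21 - 12 * ζ^22 + 12 * ζ^23 - 24 * ζ^24 +
        18 * ζ^25 - 26 * ζ^26 + 24 * ζ^27 - 16 * ζ^28 + 16 * ζ^29 - 4 * ζ^30 + 4 * ζ^31)) * h15)]
  norm_num [coeff_X_pow, coeff_X, coeff_C]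

/-- `Tr(ζ′sθ^5) = 60` for `ζ′ = π₃ξ, π₃ = ζ¹²(1 − ζ⁵)(1 − ζ)`, `s = √−15 = (1 + 2ζ⁵)(1 + 2(ζ³ + ζ¹²))`, `θ = ζ + ζ⁻¹` (Euler evaluation). research route conditional on HC_CM; not a corollary; Q11.4-sentence-2 already refuted in dim ≥ 3. [folklore] -/
theorem trace_piThree_sqrtNegFifteen_five [IsCyclotomicExtension {15} ℚ K] (hζ : IsPrimitiveRoot ζ 15) :
    Algebra.trace ℚ K ((ζ ^ 12 * (1 - ζ ^ 5) * (1 - ζ) * (ζ ^ 3 * (aeval ζ (derivative (cyclotomic 15 ℚ)))⁻¹)) * ((1 + 2 * ζ ^ 5) * (1 + 2 * (ζ ^ 3 + ζ ^ 12))) * (ζ + ζ⁻¹) ^ 5) = 60 := by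
  have h15 : ζ ^ 15 = 1 := hζ.pow_eq_one
  have hΦ := cyc_fifteen hζ
  rw [trace_of_key hζ (C (108 : ℚ) + C (-159 : ℚ) * X + C (141 : ℚ) * X ^ 2 + C (-30 : ℚ) * X ^ 3 + C (-81 : ℚ) * X ^ 4 +
      C (159 : ℚ) * X ^ 5 + C (-168 : ℚ) * X ^ 6 + C (60 : ℚ) * X ^ 7) (by compute_degree) (by
    simp only [map_add, map_mul, map_pow, aeval_C, aeval_X, map_neg, eq_ratCast, Rat.cast_ofNat]
    linear_combination ((aeval ζ (derivative (cyclotomic 15 ℚ)))⁻¹ * (-48 - 47 * ζ^2 + 52 * ζ^3 - 30 * ζ^4 - 4 * ζ^5 +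
        47 * ζ^6)) * hΦ +
      ((aeval ζ (derivative (cyclotomic 15 ℚ)))⁻¹ * (-48 + 48 * ζ - 47 * ζ^2 + 51 * ζ^3 - 34 * ζ^4 +
        39 * ζ^5 - 9 * ζ^6 + 13 * ζ^7 - 13 * ζ^9 + 9 * ζ^10 - 39 * ζ^11 + 34 * ζ^12 - 51 * ζ^13 +
        47 * ζ^14 - 49 * ζ^15 + 49 * ζ^16 - 52 * ζ^17 + 54 * ζ^18 - 42 * ζ^19 + 38 * ζ^20 - 8 * ζ^21 - 2 * ζ^22 +
        18 * ζ^23 - 36 * ζ^24 + 30 * ζ^25 - 50 * ζ^26 + 42 * ζ^27 - 42 * ζ^28 + 40 * ζ^29 - 20 * ζ^30 +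
        20 * ζ^31 - 4 * ζ^32 + 4 * ζ^33)) * h15)]
  norm_num [coeff_X_pow, coeff_X, coeff_C]

/-- `Tr(ζ′sθ^6) = -216` for `ζ′ = π₃ξ, π₃ = ζ¹²(1 − ζ⁵)(1 − ζ)`, `s = √−15 = (1 + 2ζ⁵)(1 + 2(ζ³ + ζ¹²))`, `θ = ζ + ζ⁻¹` (Euler evaluation). research route conditional on HC_CM; not a corollary; Q11.4-sentence-2 already refuted in dim ≥ 3. [folklore] -/
theorem trace_piThree_sqrtNegFifteen_six [IsCyclotomicExtension {15} ℚ K] (hζ : IsPrimitiveRoot ζ 15) :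
    Algebra.trace ℚ K ((ζ ^ 12 * (1 - ζ ^ 5) * (1 - ζ) * (ζ ^ 3 * (aeval ζ (derivative (cyclotomic 15 ℚ)))⁻¹)) * ((1 + 2 * ζ ^ 5) * (1 + 2 * (ζ ^ 3 + ζ ^ 12))) * (ζ + ζ⁻¹) ^ 6) = -216 := by
  have h15 : ζ ^ 15 = 1 := hζ.pow_eq_one
  have hΦ := cyc_fifteen hζ
  rw [trace_of_key hζ (C (-111 : ℚ) + C (309 : ℚ) * X + C (-297 : ℚ) * X ^ 2 + C (108 : ℚ) * X ^ 3 + C (81 : ℚ) * X ^ 4 +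
      C (-309 : ℚ) * X ^ 5 + C (327 : ℚ) * X ^ 6 + C (-216 : ℚ) * X ^ 7) (by compute_degree) (by
    simp only [map_add, map_mul, map_pow, aeval_C, aeval_X, map_neg, eq_ratCast, Rat.cast_ofNat]
    linear_combination ((aeval ζ (derivative (cyclotomic 15 ℚ)))⁻¹ * (-99 - 4 * ζ - 99 * ζ^2 + 99 * ζ^3 - 77 * ζ^4 + 207 * ζ^5 +
        81 * ζ^6)) * hΦ +
      ((aeval ζ (derivative (cyclotomic 15 ℚ)))⁻¹ * (-99 + 95 * ζ - 95 * ζ^2 + 99 * ζ^3 - 81 * ζ^4 +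
        90 * ζ^5 - 43 * ζ^6 + 52 * ζ^7 - 9 * ζ^8 + 9 * ζ^10 - 52 * ζ^11 + 43 * ζ^12 - 90 * ζ^13 +
        81 * ζ^14 - 100 * ζ^15 + 96 * ζ^16 - 101 * ζ^17 + 103 * ζ^18 - 94 * ζ^19 + 92 * ζ^20 - 50 * ζ^21 +
        36 * ζ^22 + 10 * ζ^23 - 38 * ζ^24 + 48 * ζ^25 - 86 * ζ^26 + 72 * ζ^27 - 92 * ζ^28 +
        82 * ζ^29 - 62 * ζ^30 + 60 * ζ^31 - 24 * ζ^32 + 24 * ζ^33 - 4 * ζ^34 + 4 * ζ^35)) * h15)]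
  norm_num [coeff_X_pow, coeff_X, coeff_C]

/-- **The Gram datum `a` of `(E_ζ′, s)` in the real frame `θ^i` (`i < 4`)** for `ζ′ = π₃ξ, π₃ = ζ¹²(1 − ζ⁵)(1 − ζ)` (type 𝔮₃ ((𝔬𝔣₀)² = (3))),
`s = √−15 = (1 + 2ζ⁵)(1 + 2(ζ³ + ζ¹²))`: the integer Hankel matrix `(−Tr(ζ′sθ^{i+j}))ᵢⱼ` (and `b = 0`, part 82 `hb_eq_zero`).
research route conditional on HC_CM; not a corollary; Q11.4-sentence-2 already refuted in dim ≥ 3. [cite: vanGeemen1994HodgeAV, Lemma 5.2 (2)–(3)] -/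
theorem realPart_piThree_sqrtNegFifteen [IsCyclotomicExtension {15} ℚ K] [IsCMField K] (hζ : IsPrimitiveRoot ζ 15)
    {x : Fin 4 → K} (hx : ∀ i, x i = (ζ + ζ⁻¹) ^ (i : ℕ)) {a : Matrix (Fin 4) (Fin 4) ℚ}
    (ha : ∀ i j, a i j = Algebra.trace ℚ K ((ζ ^ 12 * (1 - ζ ^ 5) * (1 - ζ) * (ζ ^ 3 * (aeval ζ (derivative (cyclotomic 15 ℚ)))⁻¹)) * x i * IsCMField.complexConj K (((1 + 2 * ζ ^ 5) * (1 + 2 * (ζ ^ 3 + ζ ^ 12))) * x j))) :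
    a = !![0, -6, 12, -18; -6, 12, -18, 54; 12, -18, 54, -60; -18, 54, -60, 216] := by
  rw [ha_eq (complexConj_sqrtNegFifteen hζ) (complexConj_thetaFrame hζ hx) ha]
  ext i j
  simp only [Matrix.of_apply, hx, ← pow_add]
  fin_cases i <;> fin_cases j <;> simp [trace_piThree_sqrtNegFifteen_zero hζ, trace_piThree_sqrtNegFifteen_one hζ, trace_piThree_sqrtNegFifteen_two hζ, trace_piThree_sqrtNegFifteen_three hζ, trace_piThree_sqrtNegFifteen_four hζ, trace_piThree_sqrtNegFifteen_five hζ, trace_piThree_sqrtNegFifteen_six hζ]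

/-- **`det a = 32400`** for `ζ′ = π₃ξ, π₃ = ζ¹²(1 − ζ⁵)(1 − ζ)`, `s = √−15 = (1 + 2ζ⁵)(1 + 2(ζ³ + ζ¹²))` (frame `θ^i`).
research route conditional on HC_CM; not a corollary; Q11.4-sentence-2 already refuted in dim ≥ 3. [cite: vanGeemen1994HodgeAV, Lemma 5.2 (3)] -/
theorem det_realPart_piThree_sqrtNegFifteen [IsCyclotomicExtension {15} ℚ K] [IsCMField K] (hζ : IsPrimitiveRoot ζ 15)
    {x : Fin 4 → K} (hx : ∀ i, x i = (ζ + ζ⁻¹) ^ (i : ℕ)) {a : Matrix (Fin 4) (Fin 4) ℚ}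
    (ha : ∀ i j, a i j = Algebra.trace ℚ K ((ζ ^ 12 * (1 - ζ ^ 5) * (1 - ζ) * (ζ ^ 3 * (aeval ζ (derivative (cyclotomic 15 ℚ)))⁻¹)) * x i * IsCMField.complexConj K (((1 + 2 * ζ ^ 5) * (1 + 2 * (ζ ^ 3 + ζ ^ 12))) * x j))) :
    a.det = 32400 := by
  rw [realPart_piThree_sqrtNegFifteen hζ hx ha]
  simp [Matrix.det_succ_row_zero, Fin.sum_univ_succ, Fin.succAbove, Matrix.submatrix]
  norm_num

/-! ### §2 Invariance and the census form -/

/-- **For EVERY skew `ζ′` of type `𝔮₃` on `ℤ[ζ₁₅]` (`IsOfType 1 ζ′ 𝔣₀`, `𝔬𝔣₀ = (π)`, `(𝔬𝔣₀)² = (3)`; `ζ′ = u·πξ`,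
`u` a real unit of norm `1` by THEOREM L (i) at `15`) the Gram determinant of `(E_ζ′, s₁₅)` in the frame `θ^i` is `32400`**
— for every `Φ` and every `Φ`-positive such `ζ′` (they exist for every `₁₅`… balanced `Φ`, part 80): class `[1]`: the SPLIT row `W4.15.1`.
research route conditional on HC_CM; not a corollary; Q11.4-sentence-2 already refuted in dim ≥ 3. [cite: vanGeemen1994HodgeAV, Lemma 5.2 (3) and (5.4.1)] [cite: Shimura1998, §14.3 Prop. 4–5, pp. 103–104] -/
theorem det_realPart_typeThree_sqrtNegFifteen [IsCyclotomicExtension {15} ℚ K] [IsCMField K]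
    (hζ : IsPrimitiveRoot ζ 15) {𝔣₀ : Ideal (𝓞 (maximalRealSubfield K))}
    (h𝔣₀ : 𝔣₀.map (algebraMap (𝓞 (maximalRealSubfield K)) (𝓞 K)) = Ideal.span {hζ.toInteger ^ 12 * (1 - hζ.toInteger ^ 5) * (1 - hζ.toInteger ^ 1)})
    {ζ' : K} (hζ' : IsCMField.complexConj K ζ' = -ζ')
    (hT : CMTypeLattice.IsOfType (1 : (FractionalIdeal (𝓞 K)⁰ K)ˣ) ζ' 𝔣₀)
    {x : Fin 4 → K} (hx : ∀ i, x i = (ζ + ζ⁻¹) ^ (i : ℕ)) {a : Matrix (Fin 4) (Fin 4) ℚ}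
    (ha : ∀ i j, a i j = Algebra.trace ℚ K (ζ' * x i * IsCMField.complexConj K (((1 + 2 * ζ ^ 5) * (1 + 2 * (ζ ^ 3 + ζ ^ 12))) * x j))) :
    a.det = 32400 := by
  obtain ⟨ωb, hωb⟩ := exists_basis_thetaPow hζ
  have hx' : ∀ i, x i = (ωb i : K) := fun i => (hx i).trans (hωb i).symm
  have hg : Nat.totient 15 = 2 * (3 + 1) := by rw [totient_fifteen]
  have hsk : IsCMField.complexConj K (ζ ^ 12 * (1 - ζ ^ 5) * (1 - ζ) * (ζ ^ 3 * (aeval ζ (derivative (cyclotomic 15 ℚ)))⁻¹)) =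
      -(ζ ^ 12 * (1 - ζ ^ 5) * (1 - ζ) * (ζ ^ 3 * (aeval ζ (derivative (cyclotomic 15 ℚ)))⁻¹)) := by
    simpa only [pow_one] using complexConj_gen_mul_xi hζ hg adm_fifteen_three
  have h0 : (ζ ^ 12 * (1 - ζ ^ 5) * (1 - ζ) * (ζ ^ 3 * (aeval ζ (derivative (cyclotomic 15 ℚ)))⁻¹)) ≠ 0 :=
    mul_ne_zero (by simpa only [pow_one] using gen_ne_zero hζ adm_fifteen_three) (xi_ne_zero hζ 3)
  have hT₀ : CMTypeLattice.IsOfType (1 : (FractionalIdeal (𝓞 K)⁰ K)ˣ) (ζ ^ 12 * (1 - ζ ^ 5) * (1 - ζ) * (ζ ^ 3 * (aeval ζ (derivative (cyclotomic 15 ℚ)))⁻¹)) 𝔣₀ := by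
    simpa only [pow_one] using isOfType_one_gen_mul_xi hζ 3 ((5, 1, 12) : ℕ × ℕ × ℕ) h𝔣₀
  rw [det_realPart_eq_of_isOfType ωb (complexConj_sqrtNegFifteen hζ) hx' (norm_realUnits_pos_fifteen hζ)
    hsk h0 hζ' hT₀ hT (fun i j => rfl) ha]
  exact det_realPart_piThree_sqrtNegFifteen hζ hx (fun i j => rfl)

open scoped Classical in
/-- **CENSUS FORM** (part 80's existence + the determinant): for every `ℚ(√−15)`-balanced CM type `Φ` of `ℚ(ζ₁₅)` and the
type `𝔣₀` with `𝔬𝔣₀ = (π)`, `(𝔬𝔣₀)² = (3)`, the torus `ℂ^Φ/Φ(ℤ[ζ₁₅])` carries a `Φ`-positive divisor of type `(K; Φ; 𝔣₀)`, and EVERY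
such divisor `X_ζ′` has van Geemen Gram determinant `32400` in the real frame `θ^i`: class `[1]`: the SPLIT row `W4.15.1`.
research route conditional on HC_CM; not a corollary; Q11.4-sentence-2 already refuted in dim ≥ 3. [cite: vanGeemen1994HodgeAV, Lemma 5.2 (3) and (5.4.1)] [cite: Shimura1998, §14.3 Prop. 4–5, pp. 103–104] -/
theorem exists_typeThree_sqrtNegFifteen_det [IsCyclotomicExtension {15} ℚ K] [IsCMField K]
    (hζ : IsPrimitiveRoot ζ 15) (Φ : CMType K)
    (hbal : 2 * (SΦ[Φ, ζ] ∩ ({7, 11, 13, 14} : Finset (ZMod 15))).card = (SΦ[Φ, ζ]).card)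
    {𝔣₀ : Ideal (𝓞 (maximalRealSubfield K))}
    (h𝔣₀ : 𝔣₀.map (algebraMap (𝓞 (maximalRealSubfield K)) (𝓞 K)) = Ideal.span {hζ.toInteger ^ 12 * (1 - hζ.toInteger ^ 5) * (1 - hζ.toInteger ^ 1)}) :
    ∃ ζ' : K, IsCMField.complexConj K ζ' = -ζ' ∧ (∀ φ : Φ.1, 0 < (φ.1 ζ').im) ∧
      CMTypeLattice.IsOfType (1 : (FractionalIdeal (𝓞 K)⁰ K)ˣ) ζ' 𝔣₀ ∧
      ∀ (x : Fin 4 → K), (∀ i, x i = (ζ + ζ⁻¹) ^ (i : ℕ)) → ∀ a : Matrix (Fin 4) (Fin 4) ℚ,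
        (∀ i j, a i j = Algebra.trace ℚ K (ζ' * x i * IsCMField.complexConj K (((1 + 2 * ζ ^ 5) * (1 + 2 * (ζ ^ 3 + ζ ^ 12))) * x j))) →
        a.det = 32400 := by
  obtain ⟨ζ', h1, h2, h3⟩ := exists_type_fifteen_three_sqrt_neg_fifteen hζ Φ hbal h𝔣₀
  exact ⟨ζ', h1, h2, h3, fun x hx a ha => det_realPart_typeThree_sqrtNegFifteen hζ h𝔣₀ h1 h3 hx ha⟩

/-! ### §3 Class in `ℚˣ/Nm(ℚ(√−15)ˣ)` -/

/-- **`[32400] = [1]`, the SPLIT class, in `ℚˣ/Nm(ℚ(√−15)ˣ)`** (`32400 = 180²`): the type-`𝔮₃` (degree `9`)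
polarised Weil-type `ℤ[ζ₁₅]`-fourfolds lie on the SPLIT component — class `[1]`: the SPLIT row `W4.15.1`.
research route conditional on HC_CM; not a corollary; Q11.4-sentence-2 already refuted in dim ≥ 3. [cite: vanGeemen1994HodgeAV, 5.4 and (5.4.1)] -/
theorem mk0_det_typeThree_sqrtNegFifteen :
    (QuotientGroup.mk (Units.mk0 (32400 : ℚ) (by norm_num)) : weilNormResidueGroup 15) =
      splitDiscriminantClass 2 15 :=
  mk_eq_split_of_even (by decide) _ (mem_normUnitsSubgroup_of_sq_add_mul_sq _ (180 : ℚ) 0 (by norm_num))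

end Summit.HodgeConjecture.Ring2WeilCoverage.WeilGramLevel15SqrtNegFifteenTypeThree

end
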